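import Summits.BirchSwinnertonDyer.BirchSwinnertonDyer.Theorems.ManinLocalTwoThreeTwoShiftDescentEngine
import HarnessLib

/-!
# The 2-ADIC TWIN, III: the 2-power tower for G₂ — automatic descent at `16 ∣ 4m`, the `χ₄`-step `2m → 4m` (`m` odd) and the
# `χ₈`-step `4m′ → 8m′` (`m′` odd); hence `K₂(2m) = D(2m) ⟹ K₂(4m) = D(4m)` for EVERY `m ≥ 1`
# (route `ManinLocalTwoThree`, cell bsd-f2-manin; crux C2 `ManinOddAtFour` stmt-BirchSwinnertonDyer-22967; prover seat p3 gen 11)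

With the engine `TwoShift.descent` (file II) a 2-shift-invariant additive `φ : Γ₀(4m) → 𝔽₂` descends to `Γ₀(2m)` as soon as
`φ(P₁) = φ(P_{1/2})`.  Here (all PROVED, elementary `2 × 2` identities):
* §1 `φ(P₁) = 0` ALWAYS (`P₁` is the shift of `P_{1/2}²`) and `φ(P_{1/2}) = 0` when `4 ∣ m` (`P_{1/2}` is the shift of `u_{1/4}²`), for
  every `ε`-eigenfunction into any commutative ring with `2 = 0` — so the descent is AUTOMATIC at `16 ∣ 4m`
  (`descent_of_four_dvd`; the twin of p3's THEOREM III at `27 ∣ M`);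
* §2 the diamond characters `χ₄ ∘ d` (kernel `{1}` in `(ℤ/4)ˣ`) and `χ₈ ∘ d` (kernel `{±1}` in `(ℤ/8)ˣ`) as `𝔽₂`-valued functions on
  `Γ₀(L)`, additive whenever `4 ∣ c_x b_y` resp. `8 ∣ c_x b_y`;
* §3 the two OBSTRUCTED steps for `ε = 1`, exactly as p3's `threeShiftStepNine_holds` (E-es-105): at `m` odd the obstruction
  `φ(P_{1/2})` is absorbed by `χ₄ ∘ d` (`χ₄(1 + 2m) = 1`), at `m = 2m′`, `m′` odd, by `χ₈ ∘ d` (`χ₈(1 + 4m′) = 1`); so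
  **`twoShift_step : TwoShiftInvariantIsDiamondAt (2m) → TwoShiftInvariantIsDiamondAt (4m)`** for every `m ≥ 1`, and the tower
  corollary `twoShiftInvariantIsDiamondAt_of_two_mul` (`K₂(2N₀·2^k) = D` from `K₂(2N₀) = D`).
What remains for G₂ at every level is the base `K₂(N₀) = D(N₀)`, `N₀` odd (p2's `twoShiftInvariant_isDiamond`) and the index-3 step
`N₀ → 2N₀` (file IV).  Nothing about BSD, Manin's conjecture or C2 is asserted here.  Reference: HOME/MEMO-es.md §37.8–37.9 (the `p = 3`
pattern) [cite: DarmonDiamondTaylor1995, Lemma 4.28 (p. 135)].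
-/

set_option autoImplicit false
set_option linter.dupNamespace false

open scoped MatrixGroups

open CongruenceSubgroup Matrix.SpecialLinearGroup
open Summit.BirchSwinnertonDyer.Rank1Residual.ManinAdditive.NineShiftEqualiser (slOf g0Of slOf_apply_00 slOf_apply_01
  slOf_apply_10 slOf_apply_11 slOf_mem_gamma0 g0Of_congr)
open Summit.BirchSwinnertonDyer.BirchSwinnertonDyer.Theorems.ManinLocalTwoThree.ThreeShiftDescent (g0Of_mul det_mul_entries
  Tpow Tpow_mul_Tpow Tpow_zero Tpow_inv g0Of_mul_Tpow Tpow_one_mul_mul_Tpow_neg_one conj_invariant_of_generator glue)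

namespace Summit.BirchSwinnertonDyer.BirchSwinnertonDyer.Theorems.ManinLocalTwoThree

namespace TwoShift

/-! ### §1. The two parabolics under an `ε`-eigenfunction: `φ(P₁) = 0` always, `φ(P_{1/2}) = 0` for `4 ∣ m` -/

section Parabolics

variable {K : Type*} [CommRing K] {m : ℕ} (φ : Gamma0 (2 * (2 * m)) → K) (ε : K)

/-- `(a, 2b; c, d)·(a, 2b; c, d)`-type squares: `(I + X)² = I + 2X` for `X = (e f; g −e)` with `X² = 0`. [folklore] -/
theorem g0Of_sq_of_sq_zero {L : ℕ} (e f g : ℤ) (hX : e * e + f * g = 0) (h₁ : (1 + e) * (1 - e) - f * g = 1)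
    (h₂ : (1 + 2 * e) * (1 - 2 * e) - (2 * f) * (2 * g) = 1) (hc₁ : (L : ℤ) ∣ g) (hc₂ : (L : ℤ) ∣ 2 * g) :
    (g0Of (1 + e) f g (1 - e) h₁ hc₁ : Gamma0 L) * g0Of (1 + e) f g (1 - e) h₁ hc₁ =
      g0Of (1 + 2 * e) (2 * f) (2 * g) (1 - 2 * e) h₂ hc₂ := by
  rw [g0Of_mul _ _ _ _ _ _ _ _ h₁ hc₁ h₁ hc₁ (det_mul_entries h₁ h₁)
      (dvd_add (Dvd.dvd.mul_right hc₁ _) (Dvd.dvd.mul_left hc₁ _))]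
  exact g0Of_congr (by linear_combination hX) (by ring) (by ring) (by linear_combination hX) _ _ _ _

/-- **`φ(P₁) = 0`** for every additive `ε`-eigenfunction `φ` on `Γ₀(4m)` into a ring with `2 = 0`: `P₁ = (1−4m, 2·2m; −4m, 1+4m)` is the
shift of `(1−4m, 2m; −8m, 1+4m) = P_{1/2}²`. [folklore] -/
theorem apply_Pone_eq_zero (h2 : (2 : K) = 0) (hadd : IsAdd φ) (hinv : IsShiftEigen ε φ) : φ (Pone m) = 0 := by
  have e1 : Pone m = g0Of (1 - 4 * m) (2 * (2 * m)) (-(4 * m)) (1 + 4 * m) (by ring) ⟨-1, by push_cast; ring⟩ :=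
    g0Of_congr rfl (by ring) rfl rfl _ _ _ _
  have hsq : Phalf m * Phalf m = g0Of (1 - 4 * m) (2 * m) (2 * -(4 * m)) (1 + 4 * m) (by ring) ⟨-2, by push_cast; ring⟩ := by
    have eP : Phalf m = g0Of (1 + -(2 * (m : ℤ))) (m : ℤ) (-(4 * (m : ℤ))) (1 - -(2 * (m : ℤ))) (by ring)
        ⟨-1, by push_cast; ring⟩ := by
      unfold Phalf; exact g0Of_congr (by ring) rfl rfl (by ring) _ _ _ _
    rw [eP, g0Of_sq_of_sq_zero (L := 2 * (2 * m)) (-(2 * (m : ℤ))) m (-(4 * m)) (by ring) (by ring) (by ring)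
      ⟨-1, by push_cast; ring⟩ ⟨-2, by push_cast; ring⟩]
    exact g0Of_congr (by ring) (by ring) (by ring) (by ring) _ _ _ _
  rw [e1, hinv (1 - 4 * m) (2 * m) (-(4 * m)) (1 + 4 * m) (by ring) ⟨-1, by push_cast; ring⟩, ← hsq,
    hadd.map_sq_eq_zero h2, mul_zero]

/-- the generator `u_{1/4} = (1 − 4j, j; −16j, 1 + 4j)` of the stabiliser of the cusp `1/4` in `Γ₀(16j)`. [folklore] -/
def uQuarter (j : ℕ) : Gamma0 (2 * (2 * (4 * j))) :=
  g0Of (1 - 4 * j) j (-(16 * j)) (1 + 4 * j) (by ring) ⟨-1, by push_cast; ring⟩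

/-- **`φ(P_{1/2}) = 0` when `4 ∣ m`** (`m = 4j`): `P_{1/2} = (1−8j, 2·2j; −16j, 1+8j)` is the shift of `(1−8j, 2j; −32j, 1+8j) = u_{1/4}²`.
[folklore] -/
theorem apply_Phalf_eq_zero_of_four_dvd {j : ℕ} (φ : Gamma0 (2 * (2 * (4 * j))) → K) (h2 : (2 : K) = 0) (hadd : IsAdd φ)
    (hinv : IsShiftEigen ε φ) : φ (Phalf (4 * j)) = 0 := by
  have e1 : Phalf (4 * j) = g0Of (1 - 2 * (4 * j)) (2 * (2 * j)) (-(4 * (4 * j))) (1 + 2 * (4 * j)) (by ring)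
      ⟨-1, by push_cast; ring⟩ := g0Of_congr rfl (by push_cast; ring) rfl rfl _ _ _ _
  have hsq : uQuarter j * uQuarter j =
      g0Of (1 - 2 * (4 * j)) (2 * j) (2 * -(4 * (4 * j))) (1 + 2 * (4 * j)) (by ring) ⟨-2, by push_cast; ring⟩ := by
    have eU : uQuarter j = g0Of (1 + -(4 * (j : ℤ))) (j : ℤ) (-(16 * (j : ℤ))) (1 - -(4 * (j : ℤ))) (by ring)
        ⟨-1, by push_cast; ring⟩ := by
      unfold uQuarter; exact g0Of_congr (by ring) rfl rfl (by ring) _ _ _ _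
    rw [eU, g0Of_sq_of_sq_zero (L := 2 * (2 * (4 * j))) (-(4 * (j : ℤ))) j (-(16 * j)) (by ring) (by ring) (by ring)
      ⟨-1, by push_cast; ring⟩ ⟨-2, by push_cast; ring⟩]
    exact g0Of_congr (by ring) (by ring) (by ring) (by ring) _ _ _ _
  rw [e1, hinv (1 - 2 * (4 * j)) (2 * j) (-(4 * (4 * j))) (1 + 2 * (4 * j)) (by ring) ⟨-1, by push_cast; ring⟩, ← hsq,
    hadd.map_sq_eq_zero h2, mul_zero]

/-- **AUTOMATIC DESCENT at `16 ∣ 4m`** (`m = 4j`; the twin of p3's THEOREM III at `27 ∣ M`): every additive `ε`-eigenfunction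
`Γ₀(16j) → K` (`2 = 0` in `K`) restricts from an additive `ε`-eigenfunction on `Γ₀(8j)`. [folklore] -/
theorem descent_of_four_dvd {j : ℕ} (φ : Gamma0 (2 * (2 * (4 * j))) → K) (h2 : (2 : K) = 0) (hadd : IsAdd φ)
    (hinv : IsShiftEigen ε φ) :
    ∃ w : Gamma0 (2 * (4 * j)) → K, IsAdd w ∧ IsShiftEigen ε w ∧ RestrictsFrom φ w :=
  descent φ ε hadd hinv (by rw [apply_Pone_eq_zero φ ε h2 hadd hinv, apply_Phalf_eq_zero_of_four_dvd ε φ h2 hadd hinv])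

end Parabolics

/-! ### §2. The diamond characters `χ₄ ∘ d` and `χ₈ ∘ d` -/

section Chi

/-- `χ₄ : ℤ/4 → 𝔽₂`, the character of `(ℤ/4)ˣ` with kernel `{1}` (junk `0` off the units). [folklore] -/
def chi4 (x : ZMod 4) : ZMod 2 := if x = 3 then 1 else 0

/-- `χ₈ : ℤ/8 → 𝔽₂`, the character of `(ℤ/8)ˣ` with kernel `{±1}` (junk `0` off the units). [folklore] -/
def chi8 (x : ZMod 8) : ZMod 2 := if x = 3 ∨ x = 5 then 1 else 0

/-- `χ₄` is additive on the units `{x : x² = 1}` of `ℤ/4`. [folklore] -/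
theorem chi4_mul (x y : ZMod 4) (hx : x * x = 1) (hy : y * y = 1) : chi4 (x * y) = chi4 x + chi4 y := by
  revert x y hx hy; decide

/-- `χ₈` is additive on the units `{x : x² = 1}` of `ℤ/8`. [folklore] -/
theorem chi8_mul (x y : ZMod 8) (hx : x * x = 1) (hy : y * y = 1) : chi8 (x * y) = chi8 x + chi8 y := by
  revert x y hx hy; decide

/-- in `ℤ/4`, `a d = 1 + 2t ⟹ d² = 1` (`d` odd). [folklore] -/
theorem sq_eq_one_of_mul_eq_one_zmod4 (a d t : ZMod 4) (h : a * d = 1 + 2 * t) : d * d = 1 := by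
  revert a d t h; decide

/-- in `ℤ/8`, `a d = 1 + 2t ⟹ d² = 1` (`d` odd). [folklore] -/
theorem sq_eq_one_of_mul_eq_one_zmod8 (a d t : ZMod 8) (h : a * d = 1 + 2 * t) : d * d = 1 := by
  revert a d t h; decide

variable {L : ℕ}

/-- `χ₄(d_γ)` on `Γ₀(L)`. [folklore] -/
def chi4d (L : ℕ) (γ : Gamma0 L) : ZMod 2 := chi4 ((((γ : SL(2, ℤ)) 1 1 : ℤ)) : ZMod 4)

/-- `χ₈(d_γ)` on `Γ₀(L)`. [folklore] -/
def chi8d (L : ℕ) (γ : Gamma0 L) : ZMod 2 := chi8 ((((γ : SL(2, ℤ)) 1 1 : ℤ)) : ZMod 8)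

/-- `d² = 1` in `ℤ/4` for `ad − bc = 1` with `c` even. [folklore] -/
theorem sq_eq_one_zmod4_of_det {a b c d : ℤ} (h : a * d - b * c = 1) (hc : (2 : ℤ) ∣ c) :
    ((d : ℤ) : ZMod 4) * ((d : ℤ) : ZMod 4) = 1 := by
  obtain ⟨k, rfl⟩ := hc
  have key : a * d = 1 + 2 * (b * k) := by linear_combination h
  have := congrArg (fun x : ℤ => (x : ZMod 4)) key
  push_cast at this
  exact sq_eq_one_of_mul_eq_one_zmod4 _ _ _ this

/-- `d² = 1` in `ℤ/8` for `ad − bc = 1` with `c` even. [folklore] -/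
theorem sq_eq_one_zmod8_of_det {a b c d : ℤ} (h : a * d - b * c = 1) (hc : (2 : ℤ) ∣ c) :
    ((d : ℤ) : ZMod 8) * ((d : ℤ) : ZMod 8) = 1 := by
  obtain ⟨k, rfl⟩ := hc
  have key : a * d = 1 + 2 * (b * k) := by linear_combination h
  have := congrArg (fun x : ℤ => (x : ZMod 8)) key
  push_cast at this
  exact sq_eq_one_of_mul_eq_one_zmod8 _ _ _ this

/-- `d_γ² = 1` in `ℤ/4` when `2 ∣ c_γ` (`d_γ` odd). [folklore] -/
theorem sq_d_zmod4 (γ : Gamma0 L) (h2 : (2 : ℤ) ∣ ((γ : SL(2, ℤ)) 1 0 : ℤ)) :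
    ((((γ : SL(2, ℤ)) 1 1 : ℤ)) : ZMod 4) * ((((γ : SL(2, ℤ)) 1 1 : ℤ)) : ZMod 4) = 1 :=
  sq_eq_one_zmod4_of_det (gamma0_det_entries γ) h2

/-- `d_γ² = 1` in `ℤ/8` when `2 ∣ c_γ` (`d_γ` odd). [folklore] -/
theorem sq_d_zmod8 (γ : Gamma0 L) (h2 : (2 : ℤ) ∣ ((γ : SL(2, ℤ)) 1 0 : ℤ)) :
    ((((γ : SL(2, ℤ)) 1 1 : ℤ)) : ZMod 8) * ((((γ : SL(2, ℤ)) 1 1 : ℤ)) : ZMod 8) = 1 :=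
  sq_eq_one_zmod8_of_det (gamma0_det_entries γ) h2

/-- the `d`-entry of a product. [folklore] -/
theorem d_entry_mul (x y : Gamma0 L) :
    (((x * y : Gamma0 L) : SL(2, ℤ)) 1 1 : ℤ) = (x : SL(2, ℤ)) 1 0 * (y : SL(2, ℤ)) 0 1 + (x : SL(2, ℤ)) 1 1 * (y : SL(2, ℤ)) 1 1 := by
  simp [Matrix.mul_apply, Fin.sum_univ_two]

/-- **`χ₄ ∘ d` is additive on pairs with `4 ∣ c_x b_y`** (`c_x`, `c_y` even). [folklore] -/
theorem chi4d_mul (x y : Gamma0 L) (hxy : (4 : ℤ) ∣ ((x : SL(2, ℤ)) 1 0 : ℤ) * (y : SL(2, ℤ)) 0 1)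
    (hx : (2 : ℤ) ∣ ((x : SL(2, ℤ)) 1 0 : ℤ)) (hy : (2 : ℤ) ∣ ((y : SL(2, ℤ)) 1 0 : ℤ)) :
    chi4d L (x * y) = chi4d L x + chi4d L y := by
  unfold chi4d
  rw [d_entry_mul, Int.cast_add, (ZMod.intCast_zmod_eq_zero_iff_dvd _ 4).mpr hxy, zero_add, Int.cast_mul]
  exact chi4_mul _ _ (sq_d_zmod4 x hx) (sq_d_zmod4 y hy)

/-- **`χ₈ ∘ d` is additive on pairs with `8 ∣ c_x b_y`** (`c_x`, `c_y` even). [folklore] -/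
theorem chi8d_mul (x y : Gamma0 L) (hxy : (8 : ℤ) ∣ ((x : SL(2, ℤ)) 1 0 : ℤ) * (y : SL(2, ℤ)) 0 1)
    (hx : (2 : ℤ) ∣ ((x : SL(2, ℤ)) 1 0 : ℤ)) (hy : (2 : ℤ) ∣ ((y : SL(2, ℤ)) 1 0 : ℤ)) :
    chi8d L (x * y) = chi8d L x + chi8d L y := by
  unfold chi8d
  rw [d_entry_mul, Int.cast_add, (ZMod.intCast_zmod_eq_zero_iff_dvd _ 8).mpr hxy, zero_add, Int.cast_mul]
  exact chi8_mul _ _ (sq_d_zmod8 x hx) (sq_d_zmod8 y hy)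

/-- the `c`-entry of `γ ∈ Γ₀(L)` is divisible by `L`. [folklore] -/
theorem level_dvd_c (γ : Gamma0 L) : (L : ℤ) ∣ ((γ : SL(2, ℤ)) 1 0 : ℤ) :=
  (ZMod.intCast_zmod_eq_zero_iff_dvd _ L).mp (Gamma0_mem.mp γ.2)

/-- `χ₄ ∘ d` is additive on `Γ₀(L)` when `4 ∣ L`. [folklore] -/
theorem isAdd_chi4d (h4 : 4 ∣ L) : IsAdd (chi4d L) := by
  intro x y
  have hx : (4 : ℤ) ∣ ((x : SL(2, ℤ)) 1 0 : ℤ) := (Int.natCast_dvd_natCast.mpr h4).trans (level_dvd_c x)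
  have hy : (4 : ℤ) ∣ ((y : SL(2, ℤ)) 1 0 : ℤ) := (Int.natCast_dvd_natCast.mpr h4).trans (level_dvd_c y)
  exact chi4d_mul x y (Dvd.dvd.mul_right hx _) ((show (2:ℤ) ∣ 4 by norm_num).trans hx)
    ((show (2:ℤ) ∣ 4 by norm_num).trans hy)

/-- `χ₈ ∘ d` is additive on `Γ₀(L)` when `8 ∣ L`. [folklore] -/
theorem isAdd_chi8d (h8 : 8 ∣ L) : IsAdd (chi8d L) := by
  intro x y
  have hx : (8 : ℤ) ∣ ((x : SL(2, ℤ)) 1 0 : ℤ) := (Int.natCast_dvd_natCast.mpr h8).trans (level_dvd_c x)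
  have hy : (8 : ℤ) ∣ ((y : SL(2, ℤ)) 1 0 : ℤ) := (Int.natCast_dvd_natCast.mpr h8).trans (level_dvd_c y)
  exact chi8d_mul x y (Dvd.dvd.mul_right hx _) ((show (2:ℤ) ∣ 8 by norm_num).trans hx)
    ((show (2:ℤ) ∣ 8 by norm_num).trans hy)

/-- `χ₄ ∘ d` is a diamond class (`d ≡ 1 (mod L)`, `4 ∣ L`). [folklore] -/
theorem isDiamond_chi4d (h4 : 4 ∣ L) : IsDiamond (chi4d L) := by
  intro γ hγ
  obtain ⟨-, h11, -⟩ := (Gamma1_mem L γ).mp hγ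
  unfold chi4d chi4
  have : ((((γ : SL(2, ℤ)) 1 1 : ℤ)) : ZMod 4) = 1 := by
    have := intCast_zmod_eq_of_dvd h4 (x := (γ 1 1 : ℤ)) (y := 1) (by push_cast; exact h11)
    push_cast at this; exact this
  simp only [this]
  decide

/-- `χ₈ ∘ d` is a diamond class (`8 ∣ L`). [folklore] -/
theorem isDiamond_chi8d (h8 : 8 ∣ L) : IsDiamond (chi8d L) := by
  intro γ hγ
  obtain ⟨-, h11, -⟩ := (Gamma1_mem L γ).mp hγ
  unfold chi8d chi8
  have : ((((γ : SL(2, ℤ)) 1 1 : ℤ)) : ZMod 8) = 1 := by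
    have := intCast_zmod_eq_of_dvd h8 (x := (γ 1 1 : ℤ)) (y := 1) (by push_cast; exact h11)
    push_cast at this; exact this
  simp only [this]
  decide

/-- A diamond `d`-function is 2-shift invariant: `χ₄ ∘ d` (the two matrices have the same `d`). [folklore] -/
theorem isTwoShiftInvariant_chi4d : IsTwoShiftInvariant (chi4d L) := by
  intro a b c d hdet hc
  rfl

/-- `χ₈ ∘ d` is 2-shift invariant. [folklore] -/
theorem isTwoShiftInvariant_chi8d : IsTwoShiftInvariant (chi8d L) := by
  intro a b c d hdet hc
  rfl

/-- `χ₄(d)` of an explicit matrix. [folklore] -/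
theorem chi4d_g0Of (a b c d : ℤ) (h : a * d - b * c = 1) (hc : (L : ℤ) ∣ c) :
    chi4d L (g0Of a b c d h hc) = chi4 ((d : ℤ) : ZMod 4) := rfl

/-- `χ₈(d)` of an explicit matrix. [folklore] -/
theorem chi8d_g0Of (a b c d : ℤ) (h : a * d - b * c = 1) (hc : (L : ℤ) ∣ c) :
    chi8d L (g0Of a b c d h hc) = chi8 ((d : ℤ) : ZMod 8) := rfl

/-- `χ₄(1 + 2m) = 1` for `m` odd, `χ₄(1 + 4k) = 0`. [folklore] -/
theorem chi4_one_add (m : ℤ) : chi4 (((1 + 4 * m : ℤ)) : ZMod 4) = 0 ∧ (Odd m → chi4 (((1 + 2 * m : ℤ)) : ZMod 4) = 1) := by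
  constructor
  · have : (((1 + 4 * m : ℤ)) : ZMod 4) = 1 := by
      push_cast; rw [show (4 : ZMod 4) = 0 from rfl]; ring
    rw [this]; decide
  · rintro ⟨k, rfl⟩
    have : (((1 + 2 * (2 * k + 1) : ℤ)) : ZMod 4) = 3 := by
      push_cast; rw [show (2 : ZMod 4) * (2 * (k : ZMod 4) + 1) = 4 * k + 2 by ring, show (4 : ZMod 4) = 0 from rfl]; ring
    rw [this]; decide

/-- `χ₈(1 + 8k) = 0`, `χ₈(1 + 4k) = 1` for `k` odd. [folklore] -/
theorem chi8_one_add (k : ℤ) : chi8 (((1 + 8 * k : ℤ)) : ZMod 8) = 0 ∧ (Odd k → chi8 (((1 + 4 * k : ℤ)) : ZMod 8) = 1) := by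
  constructor
  · have : (((1 + 8 * k : ℤ)) : ZMod 8) = 1 := by
      push_cast; rw [show (8 : ZMod 8) = 0 from rfl]; ring
    rw [this]; decide
  · rintro ⟨j, rfl⟩
    have : (((1 + 4 * (2 * j + 1) : ℤ)) : ZMod 8) = 5 := by
      push_cast; rw [show (4 : ZMod 8) * (2 * (j : ZMod 8) + 1) = 8 * j + 4 by ring, show (8 : ZMod 8) = 0 from rfl]; ring
    rw [this]; decide

end Chi

/-! ### §3. The obstructed steps for `ε = 1` and the 2-power tower for G₂ -/

section Steps

variable {m : ℕ}

/-- absorb the obstruction by a diamond `d`-function `χ`: if `χ(P₁) = 0`, `χ(P_{1/2}) = 1`, `χ` additive 2-shift-invariant diamond on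
`Γ₀(4m)`, then `K₂(2m) = D(2m) ⟹ K₂(4m) = D(4m)`. [folklore] -/
theorem step_of_absorber (χ : Gamma0 (2 * (2 * m)) → ZMod 2) (hχadd : IsAdd χ) (hχinv : IsTwoShiftInvariant χ)
    (hχD : IsDiamond χ) (hχ1 : χ (Pone m) = 0) (hχ2 : χ (Phalf m) = 1)
    (hyp : TwoShiftInvariantIsDiamondAt (2 * m)) : TwoShiftInvariantIsDiamondAt (2 * (2 * m)) := by
  intro φ hadd hinv
  have hinv' : IsShiftEigen (1 : ZMod 2) φ := (isTwoShiftInvariant_iff_isShiftEigen_one φ).mp hinv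
  set c₀ := φ (Phalf m) with hc₀
  set φ' : Gamma0 (2 * (2 * m)) → ZMod 2 := fun g => φ g - c₀ * χ g with hφ'
  have hadd' : IsAdd φ' := fun x y => by simp only [hφ', hadd x y, hχadd x y]; ring
  have hinvφ' : IsShiftEigen (1 : ZMod 2) φ' := by
    intro a b c d hdet hc
    simp only [hφ', one_mul]
    rw [hinv a b c d hdet hc, hχinv a b c d hdet hc]
  have hP : φ' (Pone m) = φ' (Phalf m) := by
    simp only [hφ', hχ1, hχ2, apply_Pone_eq_zero φ 1 rfl hadd hinv']
    rw [hc₀]; ring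
  obtain ⟨w, hwadd, hwinv, hres⟩ := descent φ' 1 hadd' hinvφ' hP
  have hwD : IsDiamond w := hyp w hwadd ((isTwoShiftInvariant_iff_isShiftEigen_one w).mpr hwinv)
  have hφ'D : IsDiamond φ' := isDiamond_of_restrictsFrom (dvd_mul_left (2 * m) 2) hres hwD
  intro γ hγ
  have h1 := hφ'D γ hγ
  have h2 := hχD γ hγ
  simp only [hφ'] at h1
  rw [h2, mul_zero, sub_zero] at h1
  exact h1

/-- **THE χ₄-STEP (`m` odd): `K₂(2m) = D(2m) ⟹ K₂(4m) = D(4m)`.** [folklore] -/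
theorem step_of_odd (hm : Odd m) (hyp : TwoShiftInvariantIsDiamondAt (2 * m)) :
    TwoShiftInvariantIsDiamondAt (2 * (2 * m)) := by
  have h4 : 4 ∣ 2 * (2 * m) := ⟨m, by ring⟩
  refine step_of_absorber (chi4d _) (isAdd_chi4d h4) isTwoShiftInvariant_chi4d (isDiamond_chi4d h4) ?_ ?_ hyp
  · rw [Pone, chi4d_g0Of]; exact_mod_cast (chi4_one_add (m : ℤ)).1
  · rw [Phalf, chi4d_g0Of]
    have hm' : Odd (m : ℤ) := by exact_mod_cast hm
    exact_mod_cast (chi4_one_add (m : ℤ)).2 hm'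

/-- **THE χ₈-STEP (`m = 2k`, `k` odd): `K₂(4k) = D(4k) ⟹ K₂(8k) = D(8k)`.** [folklore] -/
theorem step_of_two_mul_odd {k : ℕ} (hk : Odd k) (hyp : TwoShiftInvariantIsDiamondAt (2 * (2 * k))) :
    TwoShiftInvariantIsDiamondAt (2 * (2 * (2 * k))) := by
  have h8 : 8 ∣ 2 * (2 * (2 * k)) := ⟨k, by ring⟩
  refine step_of_absorber (m := 2 * k) (chi8d _) (isAdd_chi8d h8) isTwoShiftInvariant_chi8d (isDiamond_chi8d h8) ?_ ?_ hyp
  · rw [Pone, chi8d_g0Of]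
    have := (chi8_one_add (k : ℤ)).1
    push_cast at this ⊢
    rw [show (1 : ZMod 8) + 4 * (2 * (k : ZMod 8)) = 1 + 8 * k by ring]
    exact this
  · rw [Phalf, chi8d_g0Of]
    have hk' : Odd (k : ℤ) := by exact_mod_cast hk
    have := (chi8_one_add (k : ℤ)).2 hk'
    push_cast at this ⊢
    rw [show (1 : ZMod 8) + 2 * (2 * (k : ZMod 8)) = 1 + 4 * k by ring]
    exact this

/-- **THE AUTOMATIC STEP (`4 ∣ m`): `K₂(2m) = D(2m) ⟹ K₂(4m) = D(4m)`.** [folklore] -/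
theorem step_of_four_dvd {j : ℕ} (hyp : TwoShiftInvariantIsDiamondAt (2 * (4 * j))) :
    TwoShiftInvariantIsDiamondAt (2 * (2 * (4 * j))) := by
  intro φ hadd hinv
  have hinv' : IsShiftEigen (1 : ZMod 2) φ := (isTwoShiftInvariant_iff_isShiftEigen_one φ).mp hinv
  obtain ⟨w, hwadd, hwinv, hres⟩ := descent_of_four_dvd 1 φ rfl hadd hinv'
  exact isDiamond_of_restrictsFrom (dvd_mul_left _ 2) hres
    (hyp w hwadd ((isTwoShiftInvariant_iff_isShiftEigen_one w).mpr hwinv))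

/-- **THE 2-POWER STEP at every `m ≥ 1`: `K₂(2m) = D(2m) ⟹ K₂(4m) = D(4m)`** (cases `m` odd / `m ≡ 2 (mod 4)` / `4 ∣ m`). [folklore] -/
theorem twoShift_step (m : ℕ) (hyp : TwoShiftInvariantIsDiamondAt (2 * m)) :
    TwoShiftInvariantIsDiamondAt (2 * (2 * m)) := by
  rcases Nat.even_or_odd m with ⟨k, rfl⟩ | hm
  · rcases Nat.even_or_odd k with ⟨j, rfl⟩ | hk
    · have e : j + j + (j + j) = 4 * j := by ring
      rw [e] at hyp ⊢
      exact step_of_four_dvd hyp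
    · rw [← two_mul] at hyp ⊢
      exact step_of_two_mul_odd hk hyp
  · exact step_of_odd hm hyp

/-- **THE TOWER: `K₂(2^(k+1) N₁) = D` from `K₂(2N₁) = D`**, every `N₁`, every `k`. [folklore] -/
theorem twoShiftInvariantIsDiamondAt_of_two_mul (N₁ : ℕ) (h : TwoShiftInvariantIsDiamondAt (2 * N₁)) (k : ℕ) :
    TwoShiftInvariantIsDiamondAt (2 ^ (k + 1) * N₁) := by
  induction k with
  | zero => simpa using h
  | succ k ih =>
    have e : 2 ^ (k + 1 + 1) * N₁ = 2 * (2 * (2 ^ k * N₁)) := by ring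
    have e' : 2 ^ (k + 1) * N₁ = 2 * (2 ^ k * N₁) := by ring
    rw [e]
    rw [e'] at ih
    exact twoShift_step _ ih

end Steps

end TwoShift

end Summit.BirchSwinnertonDyer.BirchSwinnertonDyer.Theorems.ManinLocalTwoThree
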